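import Summits.QuantumFields.YangMills.Theorems.SwapVirialDeficitQuantitativeLaplaceHessianLipschitz
import Summits.QuantumFields.YangMills.Theorems.SwapVirialDeficitQuantitativeLaplaceFibreMinimiser
import HarnessLib

/-!
# Route `SwapVirialDeficit` (YangMills): quantitative Laplace method — THE FIBRE PACKAGE
# (follower minimiser: existence, continuity, measurability, location, quadratic floor, Lipschitz dependence — from jets-level hypotheses)

Width seat `ym-line-sfw-p2-w2` g58 (cell ym-idea-1, free hands), `--supports stmt-QuantumFields-24197`; ONE socket theorem for the LEAD g97 plan's
bricks W6 (T1)∕(T2) of the window-uniform («Morse–Bott ∕ fibred Laplace») road to `SwapGluedStiffness`.  The model side (fcl-p3 g47's jets J1–J3,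
w3 g65's chart boxes) verifies only: the phase `G ∈ C³(X × V)` (leaders `X` normed, followers `V` EUCLIDEAN — an inner-product space, as in ✓`strongConvex_of_hessian_lower`), a Hessian FLOOR `λ‖v‖² ≤ D²_yG(x,0)[v,v]`
at the reference fibre point, bounds `‖D²G‖ ≤ M₂`, `‖D³G‖ ≤ M₃` on `S × B̄(0,ρ)` (`S ⊆ X` convex, containing the base points `ι p`), and SMALL fibre
gradients `‖D_yG(ι p, 0)‖ < (λ − M₃ρ)ρ∕2`; the package returns the follower minimiser `y⋆ : M → V` with everything ✓`laplaceMethod_quantitative_skewProduct_of_taylor`,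
✓`setIntegral_exp_neg_mul_le_gaussian_of_floor` and the (T2) form-Lipschitz step consume.

* §1 `contDiff_fibre`, `iteratedFDeriv_fibre_apply` (all orders: `Dⁱ(G(x,·))(y)[m] = DⁱG(x,y)[(0,m₁),…,(0,mᵢ)]`), `norm_iteratedFDeriv_fibre_le`
  (`‖Dⁱ(G(x,·))(y)‖ ≤ ‖DⁱG(x,y)‖`).
* §2 ★★ `fibre_hsc_of_hessian_floor` — floor `λ` at `y = 0` + `‖D³G‖ ≤ M₃` on the fibre ball ⟹ first-order STRONG CONVEXITY of every fibre `G(ι p,·)` on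
  `B̄(0,ρ)` with constant `λ − M₃ρ` (✓`hessian_lower_on_closedBall_of_third` ∘ ✓`strongConvex_of_hessian_lower`).
* §3 ★★★ `fibrePackage_of_hessian_floor` — `∃ y⋆ : M → V` continuous and measurable with, for every `p`: `y⋆(p) ∈ B(0,ρ)`, `D_yG(ι p, y⋆ p) = 0`,
  `IsMinOn`, `‖y⋆ p‖ ≤ ‖D_yG(ι p,0)‖∕(λ − M₃ρ)`, the QUADRATIC FLOOR `G(ι p, y⋆ p) + ((λ − M₃ρ)∕2)‖y − y⋆ p‖² ≤ G(ι p, y)` on `B̄(0,ρ)`; and the LIPSCHITZ law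
  `(λ − M₃ρ)‖y⋆ p − y⋆ p′‖ ≤ M₂‖ι p − ι p′‖`.
* §5 (appended) `continuous_hessianForm_comp`, ★ `continuous_fibreHessianForm`, ★ `measurable_fibreHessianForm`, `measurable_inner_of_eq_fibreHessianForm` — the `hAm`
  measurability sockets of the fibred cores along continuous base data `ι`, `y⋆`.
* §4 ★★ `abs_followerHessianForm_sub_le` — (T2) by name: `|D²_yG(ι p, y⋆ p)[v,v] − D²_yG(ι p′, y⋆ p′)[v,v]| ≤ M₃·max(1, M₂∕(λ − M₃ρ))·‖ι p − ι p′‖·‖v‖²`.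

HONEST FRAMING: generic calculus; no model object (twistTrace, Haar, SU(2), jets) appears; ⟨24197⟩ `SwapGluedStiffness`, ⟨24196⟩, ⟨22884⟩ stay OPEN; no stub ∕
crux ∕ rung ∕ summit is closed; the Yang–Mills mass gap is NOT proved; no summit is proved by a line.  0 definitions, 0 `sorry`, standard axioms.
References: [cite: HasenpflugRudolfSprungk2024, §3.1 Assumptions 1–3] (fibred Laplace setting), [folklore].
-/

set_option linter.style.longLine false
set_option linter.style.longFile 0
set_option linter.unusedSectionVars false

noncomputable section

open _root_.Set _root_.Metric

namespace Summit.QuantumFields.YangMills.Theorems.QuantitativeLaplace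

/-! ### §1 Fibre calculus on a product -/

section FibreCalculus

variable {X : Type*} [NormedAddCommGroup X] [NormedSpace ℝ X] {V : Type*} [NormedAddCommGroup V] [NormedSpace ℝ V]

/-- **Fibres of a `Cⁿ` function are `Cⁿ`.** [folklore] -/
theorem contDiff_fibre {G : X × V → ℝ} {n : WithTop ℕ∞} (hG : ContDiff ℝ n G) (x : X) : ContDiff ℝ n fun y => G (x, y) :=
  hG.comp (contDiff_const.prodMk contDiff_id)

/-- **Fibre derivatives of all orders are the full derivatives on `(0, ·)`**: `Dⁱ(G(x,·))(y)[m] = DⁱG(x,y)[(0,m₁),…,(0,mᵢ)]` (`i ≤ n`, `G ∈ Cⁿ`). [folklore] -/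
theorem iteratedFDeriv_fibre_apply {G : X × V → ℝ} {n : WithTop ℕ∞} (hG : ContDiff ℝ n G) {i : ℕ} (hi : (i : WithTop ℕ∞) ≤ n) (x : X) (y : V)
    (m : Fin i → V) :
    iteratedFDeriv ℝ i (fun y' => G (x, y')) y m = iteratedFDeriv ℝ i G (x, y) (fun k => ((0 : X), m k)) := by
  have hfun : (fun y' : V => G (x, y')) = (fun z : X × V => G ((x, (0 : V)) + z)) ∘ (ContinuousLinearMap.inr ℝ X V) := by
    funext y'
    simp only [Function.comp_apply, ContinuousLinearMap.inr_apply, Prod.mk_add_mk, add_zero, zero_add]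
  have hGt : ContDiff ℝ n fun z : X × V => G ((x, (0 : V)) + z) := hG.comp (contDiff_const.add contDiff_id)
  rw [hfun, ContinuousLinearMap.iteratedFDeriv_comp_right _ hGt y hi, ContinuousMultilinearMap.compContinuousLinearMap_apply,
    iteratedFDeriv_comp_add_left]
  simp only [ContinuousLinearMap.inr_apply, Prod.mk_add_mk, add_zero, zero_add]

/-- **Fibre derivatives are bounded by full derivatives**: `‖Dⁱ(G(x,·))(y)‖ ≤ ‖DⁱG(x,y)‖`. [folklore] -/
theorem norm_iteratedFDeriv_fibre_le {G : X × V → ℝ} {n : WithTop ℕ∞} (hG : ContDiff ℝ n G) {i : ℕ} (hi : (i : WithTop ℕ∞) ≤ n) (x : X) (y : V) :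
    ‖iteratedFDeriv ℝ i (fun y' => G (x, y')) y‖ ≤ ‖iteratedFDeriv ℝ i G (x, y)‖ := by
  refine ContinuousMultilinearMap.opNorm_le_bound (norm_nonneg _) fun m => ?_
  rw [iteratedFDeriv_fibre_apply hG hi]
  refine (ContinuousMultilinearMap.le_opNorm _ _).trans (le_of_eq ?_)
  congr 1
  exact Finset.prod_congr rfl fun k _ => by simp [Prod.norm_def]

end FibreCalculus

/-! ### §2 Strong convexity of the fibres from a floor at the reference point -/

section Floor

variable {X : Type*} [NormedAddCommGroup X] [NormedSpace ℝ X] {V : Type*} [NormedAddCommGroup V] [InnerProductSpace ℝ V] {M : Type*}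

/-- ★★ **First-order strong convexity of every fibre from a Hessian floor at `y = 0` and a `D³` bound**: with `λ‖v‖² ≤ D²_yG(ι p, 0)[v,v]` and
`‖D³G(ι p, y)‖ ≤ M₃` for `y ∈ B̄(0,ρ)`, every fibre `G(ι p, ·)` satisfies the `hsc` hypothesis of ✓`exists_fibreMinimiser` ∕ ✓`continuous_fibreMinimiser` on
`B̄(0,ρ)` with constant `λ − M₃ρ`. [folklore] -/
theorem fibre_hsc_of_hessian_floor {ι : M → X} {G : X × V → ℝ} (hG : ContDiff ℝ 3 G) {lam M₃ ρ : ℝ}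
    (hfloor : ∀ p, ∀ v : V, lam * ‖v‖ ^ 2 ≤ iteratedFDeriv ℝ 2 (fun y => G (ι p, y)) 0 (fun _ => v))
    (hM₃ : ∀ p, ∀ y ∈ closedBall (0 : V) ρ, ‖iteratedFDeriv ℝ 3 G (ι p, y)‖ ≤ M₃) :
    ∀ p, ∀ y₀ ∈ closedBall (0 : V) ρ, ∀ y ∈ closedBall (0 : V) ρ,
      G (ι p, y₀) + fderiv ℝ (fun y' => G (ι p, y')) y₀ (y - y₀) + (lam - M₃ * ρ) / 2 * ‖y - y₀‖ ^ 2 ≤ G (ι p, y) := by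
  intro p
  have h23 : (2 : WithTop ℕ∞) ≤ 3 := by exact_mod_cast (show (2 : ℕ) ≤ 3 by norm_num)
  have h33 : ((3 : ℕ) : WithTop ℕ∞) ≤ 3 := by exact_mod_cast (le_refl 3)
  have hF3 : ContDiff ℝ 3 (fun y' => G (ι p, y')) := contDiff_fibre hG (ι p)
  have hF2 : ContDiff ℝ 2 (fun y' => G (ι p, y')) := hF3.of_le h23
  have hM' : ∀ z ∈ closedBall (0 : V) ρ, ‖iteratedFDeriv ℝ 3 (fun y' => G (ι p, y')) z‖ ≤ M₃ := fun z hz =>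
    (norm_iteratedFDeriv_fibre_le hG h33 (ι p) z).trans (hM₃ p z hz)
  have hH : ∀ z ∈ closedBall (0 : V) ρ, ∀ v : V,
      (lam - M₃ * ρ) * ‖v‖ ^ 2 ≤ iteratedFDeriv ℝ 2 (fun y' => G (ι p, y')) z (fun _ => v) :=
    hessian_lower_on_closedBall_of_third hF3 (x₀ := (0 : V)) hM' (hfloor p)
  exact strongConvex_of_hessian_lower hF2 hH

end Floor

/-! ### §3 The fibre package -/

section Package

variable {X : Type*} [NormedAddCommGroup X] [NormedSpace ℝ X]
variable {V : Type*} [NormedAddCommGroup V] [InnerProductSpace ℝ V] [FiniteDimensional ℝ V] [MeasurableSpace V] [BorelSpace V]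
variable {M : Type*} [TopologicalSpace M] [MeasurableSpace M] [OpensMeasurableSpace M]

/-- ★★★ **THE FIBRE PACKAGE.**  Leaders `X`, followers `V` (Euclidean), base points `ι : M → X` (continuous) inside a convex `S ⊆ X`, phase `G ∈ C³(X × V)` with
a Hessian FLOOR `λ‖v‖² ≤ D²_yG(ι p, 0)[v,v]`, derivative bounds `‖D²G‖ ≤ M₂`, `‖D³G‖ ≤ M₃` on `S × B̄(0,ρ)`, `M₃ρ < λ`, and SMALL fibre gradients
`‖D_yG(ι p, 0)‖ < (λ − M₃ρ)ρ∕2`.  Then there is a follower minimiser `y⋆ : M → V`, CONTINUOUS and MEASURABLE, with for every `p`: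
`y⋆ p ∈ B(0,ρ)`, `D_yG(ι p, y⋆ p) = 0`, `y⋆ p` minimises `G(ι p,·)` on `B̄(0,ρ)`, `‖y⋆ p‖ ≤ ‖D_yG(ι p, 0)‖∕(λ − M₃ρ)`, the QUADRATIC FLOOR
`G(ι p, y⋆ p) + ((λ − M₃ρ)∕2)‖y − y⋆ p‖² ≤ G(ι p, y)` on `B̄(0,ρ)` — and the LIPSCHITZ law `(λ − M₃ρ)‖y⋆ p − y⋆ p′‖ ≤ M₂‖ι p − ι p′‖`.
[cite: HasenpflugRudolfSprungk2024, §3.1 Assumptions 1–3] [folklore] -/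
theorem fibrePackage_of_hessian_floor {ι : M → X} (hι : Continuous ι) {G : X × V → ℝ} (hG : ContDiff ℝ 3 G) {lam M₂ M₃ ρ : ℝ}
    (hρ : 0 < ρ) (hlam : M₃ * ρ < lam) {S : Set X} (hS : Convex ℝ S) (hιS : ∀ p, ι p ∈ S)
    (hfloor : ∀ p, ∀ v : V, lam * ‖v‖ ^ 2 ≤ iteratedFDeriv ℝ 2 (fun y => G (ι p, y)) 0 (fun _ => v))
    (hM₂ : ∀ x ∈ S, ∀ y ∈ closedBall (0 : V) ρ, ‖iteratedFDeriv ℝ 2 G (x, y)‖ ≤ M₂)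
    (hM₃ : ∀ x ∈ S, ∀ y ∈ closedBall (0 : V) ρ, ‖iteratedFDeriv ℝ 3 G (x, y)‖ ≤ M₃)
    (hgrad : ∀ p, ‖fderiv ℝ (fun y => G (ι p, y)) 0‖ < (lam - M₃ * ρ) * ρ / 2) :
    ∃ ys : M → V, Continuous ys ∧ Measurable ys ∧
      (∀ p, ys p ∈ ball (0 : V) ρ ∧ fderiv ℝ (fun y => G (ι p, y)) (ys p) = 0 ∧
        IsMinOn (fun y => G (ι p, y)) (closedBall (0 : V) ρ) (ys p) ∧
        ‖ys p‖ ≤ ‖fderiv ℝ (fun y => G (ι p, y)) 0‖ / (lam - M₃ * ρ) ∧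
        ∀ y ∈ closedBall (0 : V) ρ, G (ι p, ys p) + (lam - M₃ * ρ) / 2 * ‖y - ys p‖ ^ 2 ≤ G (ι p, y)) ∧
      ∀ p p', (lam - M₃ * ρ) * ‖ys p - ys p'‖ ≤ M₂ * ‖ι p - ι p'‖ := by
  have hlam' : 0 < lam - M₃ * ρ := sub_pos.2 hlam
  have hsc := fibre_hsc_of_hessian_floor hG hfloor (fun p y hy => hM₃ (ι p) (hιS p) y hy)
  -- the fibre family `F(p, y) = G(ι p, y)`
  have hFc : Continuous fun q : M × V => G (ι q.1, q.2) := hG.continuous.comp ((hι.comp continuous_fst).prodMk continuous_snd)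
  have hsc' : ∀ p, ∀ x₀ ∈ closedBall (0 : V) ρ, ∀ x ∈ closedBall (0 : V) ρ,
      (fun q : M × V => G (ι q.1, q.2)) (p, x₀) + fderiv ℝ (fun y => (fun q : M × V => G (ι q.1, q.2)) (p, y)) x₀ (x - x₀) +
        (lam - M₃ * ρ) / 2 * ‖x - x₀‖ ^ 2 ≤ (fun q : M × V => G (ι q.1, q.2)) (p, x) := hsc
  have hgrad' : ∀ p, ‖fderiv ℝ (fun y => (fun q : M × V => G (ι q.1, q.2)) (p, y)) 0‖ < (lam - M₃ * ρ) * ρ / 2 := hgrad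
  obtain ⟨ys, hys⟩ := exists_fibreMinimiser hlam' hρ hFc hsc' hgrad'
  have hysc : ∀ p, ys p ∈ closedBall (0 : V) ρ := fun p => ball_subset_closedBall (hys p).1
  have hcrit : ∀ p, fderiv ℝ (fun y => G (ι p, y)) (ys p) = 0 := fun p => (hys p).2.2.1
  have hcont : Continuous ys := continuous_fibreMinimiser hlam' hFc hsc' hysc hcrit
  refine ⟨ys, hcont, hcont.measurable, fun p => ⟨(hys p).1, hcrit p, (hys p).2.1, (hys p).2.2.2, fun y hy =>
    quadratic_growth_of_strongConvex (hsc p) (hysc p) (hcrit p) hy⟩, fun p p' => ?_⟩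
  -- Lipschitz law
  have hG2 : ContDiff ℝ 2 G := hG.of_le (by norm_num)
  have hconv : Convex ℝ (S ×ˢ closedBall (0 : V) ρ) := hS.prod (convex_closedBall 0 ρ)
  have hM₂' : ∀ z ∈ S ×ˢ closedBall (0 : V) ρ, ‖iteratedFDeriv ℝ 2 G z‖ ≤ M₂ := fun z hz => hM₂ z.1 hz.1 z.2 hz.2
  exact norm_fibreMinimiser_sub_le hG2 hconv hM₂' (hsc p) (hysc p) (hysc p') (hcrit p) (hcrit p') (mk_mem_prod (hιS p) (hysc p')) (mk_mem_prod (hιS p') (hysc p'))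

/-! ### §4 (T2) by name: the follower Hessian form is Lipschitz in the leader position -/

omit [FiniteDimensional ℝ V] [MeasurableSpace V] [BorelSpace V] [TopologicalSpace M] [MeasurableSpace M] [OpensMeasurableSpace M] in
/-- ★★ **(T2): the follower Hessian field `A_F(p) = D²_yG(ι p, y⋆ p)` is FORM-LIPSCHITZ in the leader position.**  With `‖D³G‖ ≤ M₃` on the convex
`S × B̄(0,ρ)`, base points in `S`, values `y⋆ p ∈ B̄(0,ρ)` obeying the Lipschitz law `λ′‖y⋆ p − y⋆ p′‖ ≤ M₂‖ι p − ι p′‖` (`λ′ > 0`; §3):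
`|D²_yG(ι p, y⋆ p)[v,v] − D²_yG(ι p′, y⋆ p′)[v,v]| ≤ M₃·max(1, M₂∕λ′)·‖ι p − ι p′‖·‖v‖²`. [folklore] -/
theorem abs_followerHessianForm_sub_le {ι : M → X} {G : X × V → ℝ} (hG : ContDiff ℝ 3 G) {lam' M₂ M₃ ρ : ℝ} (hlam' : 0 < lam')
    {S : Set X} (hS : Convex ℝ S) (hιS : ∀ p, ι p ∈ S)
    (hM₃ : ∀ x ∈ S, ∀ y ∈ closedBall (0 : V) ρ, ‖iteratedFDeriv ℝ 3 G (x, y)‖ ≤ M₃)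
    {ys : M → V} (hys : ∀ p, ys p ∈ closedBall (0 : V) ρ) (hLip : ∀ p p', lam' * ‖ys p - ys p'‖ ≤ M₂ * ‖ι p - ι p'‖)
    (p p' : M) (v : V) :
    |iteratedFDeriv ℝ 2 (fun y => G (ι p, y)) (ys p) (fun _ => v) - iteratedFDeriv ℝ 2 (fun y => G (ι p', y)) (ys p') (fun _ => v)| ≤
      M₃ * max 1 (M₂ / lam') * ‖ι p - ι p'‖ * ‖v‖ ^ 2 := by
  have hconv : Convex ℝ (S ×ˢ closedBall (0 : V) ρ) := hS.prod (convex_closedBall 0 ρ)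
  have hM₃' : ∀ z ∈ S ×ˢ closedBall (0 : V) ρ, ‖iteratedFDeriv ℝ 3 G z‖ ≤ M₃ := fun z hz => hM₃ z.1 hz.1 z.2 hz.2
  have h := abs_fibreHessianForm_sub_le_of_third hG hconv hM₃' (z := (ι p, ys p)) (z' := (ι p', ys p')) (mk_mem_prod (hιS p) (hys p)) (mk_mem_prod (hιS p') (hys p')) v
  have hM0 : 0 ≤ M₃ := le_trans (norm_nonneg _) (hM₃ _ (hιS p) _ (hys p))
  -- `‖(ι p, y⋆ p) − (ι p′, y⋆ p′)‖ = max ‖ι p − ι p′‖ ‖y⋆ p − y⋆ p′‖ ≤ max(1, M₂/λ′)‖ι p − ι p′‖`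
  have hy : ‖ys p - ys p'‖ ≤ M₂ / lam' * ‖ι p - ι p'‖ := by
    rw [div_mul_eq_mul_div, le_div_iff₀ hlam', mul_comm]
    exact hLip p p'
  have hnorm : ‖((ι p, ys p) : X × V) - (ι p', ys p')‖ ≤ max 1 (M₂ / lam') * ‖ι p - ι p'‖ := by
    rw [Prod.mk_sub_mk, Prod.norm_def]
    refine max_le ?_ ?_
    · calc ‖ι p - ι p'‖ = 1 * ‖ι p - ι p'‖ := (one_mul _).symm
        _ ≤ max 1 (M₂ / lam') * ‖ι p - ι p'‖ := by gcongr; exact le_max_left _ _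
    · exact hy.trans (by gcongr; exact le_max_right _ _)
  calc |iteratedFDeriv ℝ 2 (fun y => G (ι p, y)) (ys p) (fun _ => v) - iteratedFDeriv ℝ 2 (fun y => G (ι p', y)) (ys p') (fun _ => v)|
      ≤ M₃ * ‖((ι p, ys p) : X × V) - (ι p', ys p')‖ * ‖v‖ ^ 2 := h
    _ ≤ M₃ * (max 1 (M₂ / lam') * ‖ι p - ι p'‖) * ‖v‖ ^ 2 := by gcongr
    _ = M₃ * max 1 (M₂ / lam') * ‖ι p - ι p'‖ * ‖v‖ ^ 2 := by ring

end Package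

/-! ### §5 (appended 2026-08-31, same seat) Continuity ∕ measurability of Hessian forms along continuous data — the `hAm` sockets

The fibred cores (✓`laplaceMethod_quantitative_fibred[_cubic]`) ask `hAm : Measurable fun z : M × V => ⟪A z.1 z.2, z.2⟫`; with the Hessian operators of
✓`exists_hessianOperator` ∕ w3 g65's ✓`exists_isSymmetric_inner_eq_hess` this is the measurability of `z ↦ D²_yG(ι z.1, y⋆ z.1)[z.2, z.2]`, which is CONTINUOUS for
`G ∈ C²`, `ι`, `y⋆` continuous (§3 delivers `y⋆` continuous). -/

section Sockets

open scoped _root_.InnerProductSpace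

variable {X : Type*} [NormedAddCommGroup X] [NormedSpace ℝ X] {V : Type*} [NormedAddCommGroup V] [NormedSpace ℝ V]

/-- **Hessian forms are jointly continuous in (point, direction) along continuous data**: `t ↦ D²G(c t)[v t, v t]` is continuous for `G ∈ Cⁿ`, `2 ≤ n`,
`c`, `v` continuous. [folklore] -/
theorem continuous_hessianForm_comp {E : Type*} [NormedAddCommGroup E] [NormedSpace ℝ E] {G : E → ℝ} {n : WithTop ℕ∞} (hG : ContDiff ℝ n G)
    (hn : (2 : WithTop ℕ∞) ≤ n) {T : Type*} [TopologicalSpace T] {c : T → E} (hc : Continuous c) {v : T → E} (hv : Continuous v) :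
    Continuous fun t => iteratedFDeriv ℝ 2 G (c t) (fun _ => v t) := by
  have hA : Continuous fun t => iteratedFDeriv ℝ 2 G (c t) := (hG.continuous_iteratedFDeriv hn).comp hc
  have hm : Continuous fun t => (fun _ : Fin 2 => v t) := continuous_pi fun _ => hv
  exact hA.eval hm

/-- ★ **The fibre Hessian form along continuous base data is continuous**: for `G ∈ C²(X × V)`, `ι : M → X` and `y⋆ : M → V` continuous,
`z ↦ D²_yG(ι z.1, y⋆ z.1)[z.2, z.2]` is continuous on `M × V`. [folklore] -/
theorem continuous_fibreHessianForm {G : X × V → ℝ} {n : WithTop ℕ∞} (hG : ContDiff ℝ n G) (hn : (2 : WithTop ℕ∞) ≤ n)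
    {M : Type*} [TopologicalSpace M] {ι : M → X} (hι : Continuous ι) {ys : M → V} (hys : Continuous ys) :
    Continuous fun z : M × V => iteratedFDeriv ℝ 2 (fun y => G (ι z.1, y)) (ys z.1) (fun _ => z.2) := by
  have hfun : (fun z : M × V => iteratedFDeriv ℝ 2 (fun y => G (ι z.1, y)) (ys z.1) (fun _ => z.2)) =
      fun z : M × V => iteratedFDeriv ℝ 2 G (ι z.1, ys z.1) (fun _ => ((0 : X), z.2)) :=
    funext fun z => iteratedFDeriv_two_fibre_apply hG hn (ι z.1) (ys z.1) z.2
  rw [hfun]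
  exact continuous_hessianForm_comp hG hn ((hι.comp continuous_fst).prodMk (hys.comp continuous_fst))
    (continuous_const.prodMk continuous_snd)

/-- ★ **`hAm` socket**: the fibre Hessian form along continuous base data is MEASURABLE on `M × V` (Borel structures; `V` finite-dimensional, hence second countable). [folklore] -/
theorem measurable_fibreHessianForm [FiniteDimensional ℝ V] [MeasurableSpace V] [BorelSpace V] {G : X × V → ℝ} {n : WithTop ℕ∞} (hG : ContDiff ℝ n G)
    (hn : (2 : WithTop ℕ∞) ≤ n) {M : Type*} [TopologicalSpace M] [MeasurableSpace M] [OpensMeasurableSpace M] {ι : M → X} (hι : Continuous ι)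
    {ys : M → V} (hys : Continuous ys) :
    Measurable fun z : M × V => iteratedFDeriv ℝ 2 (fun y => G (ι z.1, y)) (ys z.1) (fun _ => z.2) :=
  (continuous_fibreHessianForm hG hn hι hys).measurable

/-- ★ **Transfer to operator letters**: if `⟪A p y, y⟫ = D²_yG(ι p, y⋆ p)[y,y]` for all `p, y`, then `z ↦ ⟪A z.1 z.2, z.2⟫` is measurable — literally the `hAm` of
✓`laplaceMethod_quantitative_fibred[_cubic]` ∕ ✓`laplaceMethod_quantitative_skewProduct_of_taylor`. [folklore] -/
theorem measurable_inner_of_eq_fibreHessianForm [FiniteDimensional ℝ V] [MeasurableSpace V] [BorelSpace V] {W : Type*} [NormedAddCommGroup W]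
    [InnerProductSpace ℝ W] {G : X × V → ℝ} {n : WithTop ℕ∞} (hG : ContDiff ℝ n G) (hn : (2 : WithTop ℕ∞) ≤ n)
    {M : Type*} [TopologicalSpace M] [MeasurableSpace M] [OpensMeasurableSpace M] {ι : M → X} (hι : Continuous ι) {ys : M → V} (hys : Continuous ys)
    {A : M → V → W} {B : M → V → W}
    (hA : ∀ p (y : V), ⟪A p y, B p y⟫_ℝ = iteratedFDeriv ℝ 2 (fun y' => G (ι p, y')) (ys p) (fun _ => y)) :
    Measurable fun z : M × V => ⟪A z.1 z.2, B z.1 z.2⟫_ℝ := by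
  have hfun : (fun z : M × V => ⟪A z.1 z.2, B z.1 z.2⟫_ℝ) = fun z : M × V => iteratedFDeriv ℝ 2 (fun y' => G (ι z.1, y')) (ys z.1) (fun _ => z.2) :=
    funext fun z => hA z.1 z.2
  rw [hfun]
  exact measurable_fibreHessianForm hG hn hι hys

end Sockets

end Summit.QuantumFields.YangMills.Theorems.QuantitativeLaplace

end
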